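/-
Copyright (c) 2026 the pub-hodgecm-mathlib formalisation cell (harness21).  Prover seat hodgecm-mathlib-LH7-p05 (g4): Track B «K2-LIT»,
hLiu418 = stmt-HodgeConjecture-24832; K1a DESK WORDS #39 (2) ∕ #40 (K2Liu-p01 (g11)) + LEAD F0P6-plan (g16) BATCH #295 (3): brick (U-N) of the «T₀-SPLIT»
road for the K1-a♮ per-place size letter `hGnb` — THE VALUE OF THE HAAR SCALAR `c_N` OF ★ B4d-3 UNDER THE UNRAMIFIED NORMALISATIONS.
-/
import Summits.HodgeConjecture.HodgeConjecture.Theorems.K2LiuSiegelIntertwiningCocycle   -- ★ B4d-3 (K2Liu-p09): `exists_measure_eq_smul_map` (`νN = c_N • e_*(μ_F ⊗ μ_R ⊗ μ_F)`)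
import Mathlib.MeasureTheory.Measure.Haar.Unique
import HarnessLib

/-!
# Crux `HLiu418`, road `K2_Liu`, socket #41 ∕ #42S KIND 1 a♮, the `hGnb` road «T₀-SPLIT», brick (U-N) — `K2LiuUnipotentHaarFactorUnramified`:
# THE HAAR SCALAR OF THE UNIPOTENT COORDINATES IS `1` AT A PLACE WHERE BOTH SIDES ARE NORMALISED ON THE INTEGRAL POINTS

Cell `hodgecm-mathlib`, crux item hLiu418 = `stmt-HodgeConjecture-24832` (helper lane `--supports … --as helper`, count-neutral); squad K2 ∕ K2Liu via the LH7 fan;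
prover LH7-p05 (g4); K1a desk K2Liu-p01 (g11) WORDS #39 (2) «T₀-SPLIT» ∕ #40 (U-N); consumer = the U-1 ∕ U-1′ editions of ★ (K1a-3)-BALL-FRAME (LH4-p07 (g12)),
which thread the Haar RELATION of ★ B4d-3 by value.  THEOREMS ONLY (no `def`, no `instance`, no notation, no named-fact hypothesis, no `sorry`); default heartbeats.

THE POINT.  ★ B4d-3 `K2LiuSiegelIntertwiningCocycle.exists_measure_eq_smul_map` reads a Haar measure `ν_N` of `N_Δ(F_v) ⊆ U(2,2)(F_v)` through additive
coordinates `e : F_v × (E ⊗ F_v) × F_v ≃ₜ N_Δ(F_v)`: `ν_N = c_N • e_*(μ_F ⊗ μ_R ⊗ μ_F)` for SOME `c_N > 0` — bare Haar uniqueness, the scalar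
`c_N = addHaarScalarFactor (e⁻¹_* ν_N) (μ_F ⊗ μ_R ⊗ μ_F)` being ∃-opaque to every consumer (★ (K1a-3)-BALL-FRAME `…TwistedBallFrame` :160, ★ (F-GK-2) :181).  Its VALUE is
read off ONE set: if a carrier `K ⊆ H_v` (the record's hyperspecial `K_{H,v} = localInt`) has `ν_N {u ∈ N_Δ | u ∈ K} = 1` (★ Φ3c's `hνK`, in the currency of
★ `K2LiuKindOneLineGoodPlaceLetters.measureReal_localInt_eq_one_of_hνK`), the coordinates READ `e(b₁, z, b₂) ∈ K ↔ b₁ ∈ 𝒪_v ∧ z ∈ B ∧ b₂ ∈ 𝒪_v` for a middle box `B`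
(at a good place: `B = 𝒪_{E_w}` resp. `𝒪_{E_{w₁}} × 𝒪_{E_{w₂}}` in the place coordinates — the n = 2 analogue of ★ `K2LiuUnipDeltaRankOneHaar.map_coordInv_primePowBall_zero`,
taken BY VALUE here as `hread`), and `μ_F(𝒪_v) = 1`, `μ_R(B) = 1`, then **`c_N = 1`**.
* §1 GENERIC — `apply_eq_coe_mul_apply_preimage` ∕ `eq_one_of_measure_eq_smul_map` (a push-forward scalar is read on one set: `ν = c • e_*μ`, `ν K = 1 = μ(e⁻¹ K)` ⇒ `c = 1`),
  and the Haar-uniqueness form `addHaarScalarFactor_eq_one_of_apply_eq_one` (two left-invariant measures giving measure `1` to one set with compact closure have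
  `addHaarScalarFactor = 1`, ★ Mathlib `measure_isAddInvariant_eq_smul_of_isCompact_closure`).
* §2 AT ★ B4d-3's FRAME — `measure_carrier_eq_of_read` (the value `ν_N {u | ↑u ∈ K} = c_N · μ_F(𝒪_v) · μ_R(B) · μ_F(𝒪_v)` under the reading), the HEAD
  **`addHaarScalarFactor_eq_one_of_unramified`** (`c_N = 1` under the reading and the three normalisations, middle factor generic), and its two place-coordinate
  corollaries `…_of_unramified_single` (non-split `v`: `μ_R = (e₁)_* μ_w`, `e₁ ζ = 1_w ζ`, ★ `exists_homeomorph_single_of_forall_eq`) and `…_of_unramified_pair`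
  (split `v`: `μ_R = (e₂)_*(μ_{w₁} ⊗ μ_{w₂})`, ★ `exists_homeomorph_single_add_single`) in the binder bytes of ★ (K1a-3)-BALL-FRAME ∕ -SPLIT.
WHAT STAYS BY VALUE: the reading `hread` (payer: the (P-good) hand of the «T₀-SPLIT» road — `Q, D, D⁻¹` `v`-integral, `|δ|_w = 1`) and the normalisations
`μ_F(𝒪_v) = 1`, `μ_w(𝒪_w) = 1` (the additive Haar measures are free parameters of ★ (K1a-3)-BALL-FRAME :133–:134).
HONEST LABEL.  Count-neutral helper, closes no socket; `HC_CM` is proved only modulo the 7 printed citations (2 remaining named inputs: hLiu418 =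
`stmt-HodgeConjecture-24832`, h413 = `stmt-HodgeConjecture-24833`) until rung 0 closes.

## References
* [Weil1965] A. Weil, *Sur la formule de Siegel dans la théorie des groupes classiques*, Acta Math. 113 (1965), §37 (Haar measures in coordinates, local volumes `1` a.e.).
* [Tate1967] J. Tate, *Fourier analysis in number fields and Hecke's zeta-functions*, in Cassels–Fröhlich (1967), §2.2, §4.1 (`μ_v(𝒪_v) = 1` for almost all `v`).
* [Casselman1980] W. Casselman, *The unramified principal series of p-adic groups I*, Compositio Math. 40 (1980), §3 (normalisation `meas(N ∩ K) = 1`).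
-/

set_option autoImplicit false
set_option linter.dupNamespace false -- the mandated namespace repeats `HodgeConjecture.HodgeConjecture`

noncomputable section

open NumberField IsDedekindDomain Matrix MeasureTheory
open scoped NNReal ENNReal
open Literature.NumberTheory.GaloisRepresentations.IsNonarchimedeanLocalField
open Literature.NumberTheory.Automorphic Literature.NumberTheory.Automorphic.UnitaryGroup
open Literature.NumberTheory.GelbartRogawski1991.AdaptedBlocks
open Literature.NumberTheory.K2Lit.LocalSiegelDoubled

namespace Summit.HodgeConjecture.HodgeConjecture.Cruxes.HLiu418.K2LiuUnipotentHaarFactorUnramified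

/-! ## §1 Generic: a push-forward scalar is read on one set -/

section Generic

variable {α β : Type*} [MeasurableSpace α] [MeasurableSpace β]

/-- the relation `ν = c • e_*μ` evaluated on a set: `ν K = c · μ(e⁻¹ K)` (no measurability needed for a measurable equivalence). [cite: Weil1965, §37] -/
theorem apply_eq_coe_mul_apply_preimage (e : α ≃ᵐ β) (μ : Measure α) (ν : Measure β) (c : ℝ≥0)
    (hν : ν = (c : ℝ≥0∞) • Measure.map e μ) (K : Set β) : ν K = (c : ℝ≥0∞) * μ (e ⁻¹' K) := by
  rw [hν, Measure.smul_apply, MeasurableEquiv.map_apply, smul_eq_mul]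

/-- **A PUSH-FORWARD SCALAR IS `1` AS SOON AS BOTH SIDES GIVE MEASURE `1` TO ONE SET**: `ν = c • e_*μ`, `ν K = 1`, `μ(e⁻¹ K) = 1` ⇒ `c = 1`. [cite: Weil1965, §37] -/
theorem eq_one_of_measure_eq_smul_map (e : α ≃ᵐ β) (μ : Measure α) (ν : Measure β) (c : ℝ≥0)
    (hν : ν = (c : ℝ≥0∞) • Measure.map e μ) {K : Set β} (hνK : ν K = 1) (hμK : μ (e ⁻¹' K) = 1) : c = 1 := by
  have h := apply_eq_coe_mul_apply_preimage e μ ν c hν K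
  rw [hνK, hμK, mul_one] at h
  exact_mod_cast h.symm

/-- the same with both normalisations in the `Measure.real` currency of the record (`ν.real K = 1`, `μ.real (e⁻¹ K) = 1`). [cite: Weil1965, §37] -/
theorem eq_one_of_measureReal_eq_smul_map (e : α ≃ᵐ β) (μ : Measure α) (ν : Measure β) (c : ℝ≥0)
    (hν : ν = (c : ℝ≥0∞) • Measure.map e μ) {K : Set β} (hνK : ν.real K = 1) (hμK : μ.real (e ⁻¹' K) = 1) : c = 1 := by
  have h := congrArg ENNReal.toReal (apply_eq_coe_mul_apply_preimage e μ ν c hν K)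
  rw [ENNReal.toReal_mul, ENNReal.coe_toReal, ← measureReal_def, ← measureReal_def, hνK, hμK, mul_one] at h
  exact_mod_cast h.symm

/-- **HAAR-UNIQUENESS FORM**: on a locally compact additive group two left-invariant measures (one of them an additive Haar measure, the other finite on compacts)
which both give measure `1` to ONE set with compact closure have `addHaarScalarFactor = 1` (★ Mathlib `measure_isAddInvariant_eq_smul_of_isCompact_closure`).
[cite: Weil1965, §37] [cite: Casselman1980, §3] -/
theorem addHaarScalarFactor_eq_one_of_apply_eq_one {G : Type*} [AddGroup G] [TopologicalSpace G] [IsTopologicalAddGroup G] [LocallyCompactSpace G]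
    [MeasurableSpace G] [BorelSpace G] (μ' μ : Measure G) [μ.IsAddHaarMeasure] [IsFiniteMeasureOnCompacts μ'] [μ'.IsAddLeftInvariant]
    {s : Set G} (hs : IsCompact (closure s)) (hμ's : μ' s = 1) (hμs : μ s = 1) : μ'.addHaarScalarFactor μ = 1 := by
  have h := Measure.measure_isAddInvariant_eq_smul_of_isCompact_closure μ' μ hs
  rw [hμ's, hμs, ENNReal.smul_def, smul_eq_mul, mul_one] at h
  exact_mod_cast h.symm

end Generic

/-! ## §2 At ★ B4d-3's frame: the scalar `c_N` of `ν_N = c_N • e_*(μ_F ⊗ μ_R ⊗ μ_F)` on `N_Δ(F_v) ⊆ U(2,2)(F_v)` -/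

section Frame

variable (F : Type) [Field F] [NumberField F] (E : Type) [Field E] [NumberField E] [Algebra F E] (c : E ≃ₐ[F] E)
  (v : HeightOneSpectrum (𝓞 F)) {J₂D : Matrix (Fin (2 + 2)) (Fin (2 + 2)) E}
  [MeasurableSpace (v.adicCompletion F)] [BorelSpace (v.adicCompletion F)] [SecondCountableTopology (v.adicCompletion F)]
  [MeasurableSpace (UnitaryGroup.LocalRing E v)] [BorelSpace (UnitaryGroup.LocalRing E v)] [SecondCountableTopology (UnitaryGroup.LocalRing E v)]
  [MeasurableSpace (unipDeltaLocal F E c v 2 (JD := J₂D))] [BorelSpace (unipDeltaLocal F E c v 2 (JD := J₂D))]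

/-- **THE VALUE OF THE CARRIER UNDER A COORDINATE READING.**  `e : F_v × (E ⊗ F_v) × F_v ≃ₜ N_Δ(F_v)` (★ B1b-2b), `ν_N = c_N • e_*(μ_F ⊗ μ_R ⊗ μ_F)` (★ B4d-3
`exists_measure_eq_smul_map`), a carrier `K ⊆ H_v` and a middle box `B ⊆ E ⊗ F_v` READING `e(b₁, z, b₂) ∈ K ↔ b₁ ∈ 𝒪_v ∧ z ∈ B ∧ b₂ ∈ 𝒪_v`:
`ν_N {u | ↑u ∈ K} = c_N · (μ_F(𝒪_v) · (μ_R(B) · μ_F(𝒪_v)))`. [cite: Weil1965, §37] -/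
theorem measure_carrier_eq_of_read
    (e : (v.adicCompletion F × UnitaryGroup.LocalRing E v × v.adicCompletion F) ≃ₜ unipDeltaLocal F E c v 2 (JD := J₂D))
    (νN : Measure (unipDeltaLocal F E c v 2 (JD := J₂D))) (μF : Measure (v.adicCompletion F))
    (μR : Measure (UnitaryGroup.LocalRing E v)) [SFinite μR] [SFinite μF]
    (cN : ℝ≥0) (hν : νN = (cN : ℝ≥0∞) • Measure.map e.toMeasurableEquiv (μF.prod (μR.prod μF)))
    (K : Set (UnitaryGroup.localPi E c (2 + 2) J₂D v)) (B : Set (UnitaryGroup.LocalRing E v))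
    (hread : ∀ (b₁ : v.adicCompletion F) (z : UnitaryGroup.LocalRing E v) (b₂ : v.adicCompletion F),
      ((e (b₁, z, b₂) : unipDeltaLocal F E c v 2 (JD := J₂D)) : UnitaryGroup.localPi E c (2 + 2) J₂D v) ∈ K ↔
        b₁ ∈ primePowBall (v.adicCompletion F) 0 ∧ z ∈ B ∧ b₂ ∈ primePowBall (v.adicCompletion F) 0) :
    νN {u : unipDeltaLocal F E c v 2 (JD := J₂D) | (u : UnitaryGroup.localPi E c (2 + 2) J₂D v) ∈ K} =
      (cN : ℝ≥0∞) * (μF (primePowBall (v.adicCompletion F) 0) * (μR B * μF (primePowBall (v.adicCompletion F) 0))) := by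
  have hpre : e.toMeasurableEquiv ⁻¹' {u : unipDeltaLocal F E c v 2 (JD := J₂D) | (u : UnitaryGroup.localPi E c (2 + 2) J₂D v) ∈ K} =
      primePowBall (v.adicCompletion F) 0 ×ˢ (B ×ˢ primePowBall (v.adicCompletion F) 0) := by
    ext ⟨b₁, z, b₂⟩
    simp only [Set.mem_preimage, Homeomorph.toMeasurableEquiv_coe, Set.mem_setOf_eq, Set.mem_prod]
    exact hread b₁ z b₂
  rw [apply_eq_coe_mul_apply_preimage e.toMeasurableEquiv _ νN cN hν, hpre, Measure.prod_prod, Measure.prod_prod]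

/-- **(U-N) THE HAAR SCALAR OF THE UNIPOTENT COORDINATES IS `1` UNDER THE UNRAMIFIED NORMALISATIONS** (middle factor generic).  With the data of
`measure_carrier_eq_of_read`: if `ν_N {u | ↑u ∈ K} = 1` (★ Φ3c's `hνK` for `K := K_{H,v}`, read by ★ `measureReal_localInt_eq_one_of_hνK`), `μ_F(𝒪_v) = 1` and `μ_R(B) = 1`,
then **`c_N = 1`**. [cite: Weil1965, §37] [cite: Tate1967, §4.1] [cite: Casselman1980, §3] -/
theorem addHaarScalarFactor_eq_one_of_unramified
    (e : (v.adicCompletion F × UnitaryGroup.LocalRing E v × v.adicCompletion F) ≃ₜ unipDeltaLocal F E c v 2 (JD := J₂D))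
    (νN : Measure (unipDeltaLocal F E c v 2 (JD := J₂D))) (μF : Measure (v.adicCompletion F))
    (μR : Measure (UnitaryGroup.LocalRing E v)) [SFinite μR] [SFinite μF]
    (cN : ℝ≥0) (hν : νN = (cN : ℝ≥0∞) • Measure.map e.toMeasurableEquiv (μF.prod (μR.prod μF)))
    (K : Set (UnitaryGroup.localPi E c (2 + 2) J₂D v)) (B : Set (UnitaryGroup.LocalRing E v))
    (hread : ∀ (b₁ : v.adicCompletion F) (z : UnitaryGroup.LocalRing E v) (b₂ : v.adicCompletion F),
      ((e (b₁, z, b₂) : unipDeltaLocal F E c v 2 (JD := J₂D)) : UnitaryGroup.localPi E c (2 + 2) J₂D v) ∈ K ↔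
        b₁ ∈ primePowBall (v.adicCompletion F) 0 ∧ z ∈ B ∧ b₂ ∈ primePowBall (v.adicCompletion F) 0)
    (hvol : νN.real {u : unipDeltaLocal F E c v 2 (JD := J₂D) | (u : UnitaryGroup.localPi E c (2 + 2) J₂D v) ∈ K} = 1)
    (hμF : μF.real (primePowBall (v.adicCompletion F) 0) = 1) (hμR : μR.real B = 1) : cN = 1 := by
  have h := congrArg ENNReal.toReal (measure_carrier_eq_of_read F E c v e νN μF μR cN hν K B hread)
  rw [ENNReal.toReal_mul, ENNReal.toReal_mul, ENNReal.toReal_mul, ENNReal.coe_toReal, ← measureReal_def, ← measureReal_def, ← measureReal_def,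
    hvol, hμF, hμR, mul_one, mul_one, mul_one] at h
  exact_mod_cast h.symm

/-- **(U-N) AT A NON-SPLIT PLACE** (`w` the place of `E` above `v`; `e₁ : E_w ≃ₜ E ⊗ F_v`, `e₁ ζ = 1_w ζ`, ★ `exists_homeomorph_single_of_forall_eq`; `μ_R := (e₁)_* μ_w` as in
★ (K1a-3)-BALL-FRAME :160 ∕ ★ (F-GK-2) :181): reading `e(b₁, z, b₂) ∈ K ↔ b₁ ∈ 𝒪_v ∧ e₁⁻¹ z ∈ 𝒪_w ∧ b₂ ∈ 𝒪_v`, `ν_N {u | ↑u ∈ K} = 1`, `μ_F(𝒪_v) = μ_w(𝒪_w) = 1` ⇒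
**`c_N = 1`**. [cite: Weil1965, §37] [cite: Tate1967, §4.1] [cite: Casselman1980, §3] -/
theorem addHaarScalarFactor_eq_one_of_unramified_single
    (e : (v.adicCompletion F × UnitaryGroup.LocalRing E v × v.adicCompletion F) ≃ₜ unipDeltaLocal F E c v 2 (JD := J₂D))
    (νN : Measure (unipDeltaLocal F E c v 2 (JD := J₂D))) (μF : Measure (v.adicCompletion F)) [SFinite μF]
    (w : PlacesOver E v) [MeasurableSpace (w.1.adicCompletion E)] [BorelSpace (w.1.adicCompletion E)] (μw : Measure (w.1.adicCompletion E)) [SFinite μw]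
    (e₁ : w.1.adicCompletion E ≃ₜ UnitaryGroup.LocalRing E v)
    (cN : ℝ≥0) (hν : νN = (cN : ℝ≥0∞) • Measure.map e.toMeasurableEquiv (μF.prod ((Measure.map (⇑e₁) μw).prod μF)))
    (K : Set (UnitaryGroup.localPi E c (2 + 2) J₂D v))
    (hread : ∀ (b₁ : v.adicCompletion F) (z : UnitaryGroup.LocalRing E v) (b₂ : v.adicCompletion F),
      ((e (b₁, z, b₂) : unipDeltaLocal F E c v 2 (JD := J₂D)) : UnitaryGroup.localPi E c (2 + 2) J₂D v) ∈ K ↔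
        b₁ ∈ primePowBall (v.adicCompletion F) 0 ∧ e₁.symm z ∈ primePowBall (w.1.adicCompletion E) 0 ∧ b₂ ∈ primePowBall (v.adicCompletion F) 0)
    (hvol : νN.real {u : unipDeltaLocal F E c v 2 (JD := J₂D) | (u : UnitaryGroup.localPi E c (2 + 2) J₂D v) ∈ K} = 1)
    (hμF : μF.real (primePowBall (v.adicCompletion F) 0) = 1) (hμw : μw.real (primePowBall (w.1.adicCompletion E) 0) = 1) : cN = 1 := by
  refine addHaarScalarFactor_eq_one_of_unramified F E c v e νN μF (Measure.map (⇑e₁) μw) cN hν K (⇑e₁.symm ⁻¹' primePowBall (w.1.adicCompletion E) 0)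
    (fun b₁ z b₂ => by rw [Set.mem_preimage]; exact hread b₁ z b₂) hvol hμF ?_
  rw [measureReal_def, show Measure.map (⇑e₁) μw = Measure.map (⇑e₁.toMeasurableEquiv) μw by rw [Homeomorph.toMeasurableEquiv_coe],
    MeasurableEquiv.map_apply, Homeomorph.toMeasurableEquiv_coe, ← Set.preimage_comp, e₁.symm_comp_self, Set.preimage_id, ← measureReal_def, hμw]

/-- **(U-N) AT A SPLIT PLACE** (`w₁ ≠ w₂` the places of `E` above `v`; `e₂ : E_{w₁} × E_{w₂} ≃ₜ E ⊗ F_v`, ★ `exists_homeomorph_single_add_single`; `μ_R := (e₂)_*(μ_{w₁} ⊗ μ_{w₂})`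
as in ★ (K1a-3)-BALL-FRAME-SPLIT :166): reading `e(b₁, z, b₂) ∈ K ↔ b₁ ∈ 𝒪_v ∧ (e₂⁻¹ z).1 ∈ 𝒪_{w₁} ∧ (e₂⁻¹ z).2 ∈ 𝒪_{w₂} ∧ b₂ ∈ 𝒪_v`, `ν_N {u | ↑u ∈ K} = 1`,
`μ_F(𝒪_v) = μ_{w₁}(𝒪_{w₁}) = μ_{w₂}(𝒪_{w₂}) = 1` ⇒ **`c_N = 1`**. [cite: Weil1965, §37] [cite: Tate1967, §4.1] [cite: Casselman1980, §3] -/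
theorem addHaarScalarFactor_eq_one_of_unramified_pair
    (e : (v.adicCompletion F × UnitaryGroup.LocalRing E v × v.adicCompletion F) ≃ₜ unipDeltaLocal F E c v 2 (JD := J₂D))
    (νN : Measure (unipDeltaLocal F E c v 2 (JD := J₂D))) (μF : Measure (v.adicCompletion F)) [SFinite μF]
    (w₁ w₂ : PlacesOver E v) [MeasurableSpace (w₁.1.adicCompletion E)] [BorelSpace (w₁.1.adicCompletion E)] [SecondCountableTopology (w₁.1.adicCompletion E)]
    [MeasurableSpace (w₂.1.adicCompletion E)] [BorelSpace (w₂.1.adicCompletion E)] [SecondCountableTopology (w₂.1.adicCompletion E)]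
    (μ₁ : Measure (w₁.1.adicCompletion E)) [SFinite μ₁] (μ₂ : Measure (w₂.1.adicCompletion E)) [SFinite μ₂]
    (e₂ : (w₁.1.adicCompletion E × w₂.1.adicCompletion E) ≃ₜ UnitaryGroup.LocalRing E v)
    (cN : ℝ≥0) (hν : νN = (cN : ℝ≥0∞) • Measure.map e.toMeasurableEquiv (μF.prod ((Measure.map (⇑e₂) (μ₁.prod μ₂)).prod μF)))
    (K : Set (UnitaryGroup.localPi E c (2 + 2) J₂D v))
    (hread : ∀ (b₁ : v.adicCompletion F) (z : UnitaryGroup.LocalRing E v) (b₂ : v.adicCompletion F),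
      ((e (b₁, z, b₂) : unipDeltaLocal F E c v 2 (JD := J₂D)) : UnitaryGroup.localPi E c (2 + 2) J₂D v) ∈ K ↔
        b₁ ∈ primePowBall (v.adicCompletion F) 0 ∧ ((e₂.symm z).1 ∈ primePowBall (w₁.1.adicCompletion E) 0 ∧ (e₂.symm z).2 ∈ primePowBall (w₂.1.adicCompletion E) 0) ∧
          b₂ ∈ primePowBall (v.adicCompletion F) 0)
    (hvol : νN.real {u : unipDeltaLocal F E c v 2 (JD := J₂D) | (u : UnitaryGroup.localPi E c (2 + 2) J₂D v) ∈ K} = 1)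
    (hμF : μF.real (primePowBall (v.adicCompletion F) 0) = 1)
    (hμ₁ : μ₁.real (primePowBall (w₁.1.adicCompletion E) 0) = 1) (hμ₂ : μ₂.real (primePowBall (w₂.1.adicCompletion E) 0) = 1) : cN = 1 := by
  refine addHaarScalarFactor_eq_one_of_unramified F E c v e νN μF (Measure.map (⇑e₂) (μ₁.prod μ₂)) cN hν K
    (⇑e₂.symm ⁻¹' (primePowBall (w₁.1.adicCompletion E) 0 ×ˢ primePowBall (w₂.1.adicCompletion E) 0))
    (fun b₁ z b₂ => by rw [Set.mem_preimage, Set.mem_prod]; exact hread b₁ z b₂) hvol hμF ?_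
  rw [measureReal_def, show Measure.map (⇑e₂) (μ₁.prod μ₂) = Measure.map (⇑e₂.toMeasurableEquiv) (μ₁.prod μ₂) by rw [Homeomorph.toMeasurableEquiv_coe],
    MeasurableEquiv.map_apply, Homeomorph.toMeasurableEquiv_coe, ← Set.preimage_comp, e₂.symm_comp_self, Set.preimage_id, Measure.prod_prod,
    ENNReal.toReal_mul, ← measureReal_def, ← measureReal_def, hμ₁, hμ₂, mul_one]

end Frame

end Summit.HodgeConjecture.HodgeConjecture.Cruxes.HLiu418.K2LiuUnipotentHaarFactorUnramified

end
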